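import Summits.BirchSwinnertonDyer.Rank1Residual.GaloisImage.KolyvaginTransverseAssembly
import Summits.BirchSwinnertonDyer.Rank1Residual.GaloisImage.KolyvaginTransverseCongruenceRat
import Summits.BirchSwinnertonDyer.Rank1Residual.GaloisImage.KolyvaginTransverseRatLocal
import Summits.BirchSwinnertonDyer.Rank1Residual.GaloisImage.ContinuousH1CoefficientTransport
import HarnessLib

/-!
# THEOREM D-tr for `T_p E` over `ℚ`: Kolyvagin's derivative classes are TRANSVERSE at the primes
# dividing the level — the END of row T-DER-TR (cell `b2b-bsdres`, team n1011, seat p15 GEN 8,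
# OWNERS row T-DER-TR = skel/T-DER-TR.md; file 4d)

HONEST FRAMING (cell `b2b-bsdres`, run/shared/lean/b2b/bsd-rank1-residual/, verbatim in every
file): the goal of the cell is to DELETE the COMBINATION-SHAPED residual classes of the
Birch–Swinnerton-Dyer formula for ALL analytic-rank `≤ 1` elliptic curves over `ℚ` — "full BSD
formula for every rank `≤ 1` curve in class `C`" assembled STRICTLY from published theorems — so
that the rank-`≤ 1` remainder becomes exactly the CONSTRUCTION-SHAPED classes, which are TYPED
(missing-input `Prop`s), NOT attempted. This is not "finishing BSD". Team n1011: research route on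
the CONSTRUCTION-SHAPED class X4 / §I N11 (route-1 PORT, (P-DER)); TOOL theorems (no definition,
no named fact, no `sorry`).

## What ([MR04] App. A, Thm. A.4 ⇒ `(κ_n)_{q,f} = 0`, for `T = T_pE` at Kolyvagin primes)

Data (THEOREM C's currency, `KolyvaginFiniteSingularRat`): an Euler system `c` of `T_pE` over
`𝓛 = cyclotomicLevelsRat p S` (`p` odd), a `p^k`-torsion coefficient object `T′` with
`red : T_pE ⟶ T′`, `T′` unramified at `q` (`hT'`, tree `GaloisRep.IsUnramifiedAt`) and
`(T′)^{G_{ℚ(μ_n)}} = 0` (`h0`), a level `n` all of whose places are Kolyvagin primes of level `k`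
(`hKol`), `q ∈ n`, the T-DER-INST generators
`σ_ℓ` (`hσ hcov hinj`), and the derivative class `κ` of THEOREM A3 (`hκ : res κ = D_n red_* c_n`).
* `Rat.exists_apply_eq_rho_sub_of_deriv` (cocycle level): for every representative `Φ` of `κ` and
  every local arithmetic Frobenius `φ₁ ∈ Γ_{ℚ_q}` fixing `μ_q` there is `t₁ ∈ T′` with
  `Φ(res φ₁) = res φ₁ · t₁ − t₁` and `Φ(res τ) = res τ · t₁ − t₁` for every `τ ∈ I_{ℚ_q}` fixing
  `μ_q` — exactly the hypotheses `hΦφ`, `hΦI` of file 4a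
  `localization_mem_transverseSubgroup_of_apply_frob`.
* `Rat.localization_deriv_mem_cyclotomicTransverse` (class level, the consumer's `ℤ`-currency):
  for a discrete Galois module `ρM` on ANOTHER group `M`, an additive equivariant `e : T′ → M`
  (`he`; GZ-1's shape, e.g. the identity, or the inclusion `E[p^k] ↪ E[p^k·p]`) and the class `κℤ`
  of a cocycle with values `e ∘ Φ` (`hΦℤ`; the (G-ℤ) glue `CoeffTransport` supplies both),
  `loc_q κℤ ∈ cyclotomicTransverse ρM (Sum.inr q)` — the `D.transverse` clause of
  `KolyvaginDatum.IsKolyvaginSystem.mem_selmerGroup` at `q ∈ n` for the canonical datum;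
  `Rat.localization_map_deriv_mem_cyclotomicTransverse`: the same for `Ψ κ`, `Ψ` ANY additive
  map `H¹(Γ_ℚ, T′) → H¹(Γ_ℚ, ρM)` computed on cocycles by `e` (the output of GZ-1
  `CoeffTransport.exists_addMonoidHom_oneCocycleClass`), no representative to choose.
Proof = file 3b `exists_apply_eq_rho_sub_of_deriv` with: `hvan` = file 4b; `hPℓ hPq hIN hodd` =
file 4c §3; `𝒢 = 𝒢_f` (file 4c §2, `f` from CK-1b `exists_frobenius_pow_datum`); `Iq = I_{𝔓₀}`
(`inertia_adicCompletionPrime_eq_map_absInertia`), `hIqT` = `galoisRepTate_eq_one_of_mem_inertia`,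
`hIvan` = E1 `apply_eq_zero_of_mem_inertia_of_mem_tate`, `h0loc` = CK-2
`injective_galoisRepTate_pow_sub_one_of_isArithFrobAtPlace` (Weil), `Frq = res φ₁`, `g₀ = Frq^f`.

References: B. Mazur, K. Rubin, *Kolyvagin systems*, Mem. AMS 799 (2004), App. A Thm. A.4 (p. 80),
Def. 1.1.6 (iv); K. Rubin, *Euler Systems* (2000), Thm. 4.5.1; B. Perrin-Riou, Ann. Inst. Fourier
48 (1998), Prop. 2.2.5 (ii).
-/

noncomputable section

open CategoryTheory Function Finset Polynomial Field IsDedekindDomain NumberField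
open scoped NumberField Pointwise
open Literature.NumberTheory Literature.NumberTheory.GaloisRepresentations
open Literature.NumberTheory.EllipticCurves
open Literature.NumberTheory.GaloisRepresentations.IsNonarchimedeanLocalField
open Literature.NumberTheory.GaloisCohomology
open Summit.BirchSwinnertonDyer.Rank1Residual.GaloisImage.CyclotomicLevel
open Rat.HeightOneSpectrum

universe u

namespace Summit.BirchSwinnertonDyer.Rank1Residual.GaloisImage

namespace Derivative

namespace Transverse

namespace Rat

variable (W : WeierstrassCurve ℚ) [W.IsElliptic] [W.IsGloballyMinimal] {p : ℕ} [Fact p.Prime]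
variable [Module.Free ℤ_[p] (W.tateModule p)] [Module.Finite ℤ_[p] (W.tateModule p)]
  [ContinuousSMul ℤ_[p] (W.tateModule p)]
variable (S : Set (HeightOneSpectrum (𝓞 ℚ)))

/-- Local notation: `T∞ = T_p E` as a continuous `G_ℚ`-representation. -/
local notation3 "T∞" => WeierstrassCurve.tateGaloisRep W p (W.continuous_galoisRepTate_holds p)

/-- Local notation: `𝓛` = the cyclotomic Euler-system levels `ℚ(μ_{p^{n+1}}, μ_r)`, `r ∩ S = ∅`. -/
local notation3 "𝓛" => cyclotomicLevelsRat p S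

/-- Local notation: `ℚq` = the completion of `ℚ` at the place `q`. -/
local notation3 "ℚ⟦" q "⟧" => IsDedekindDomain.HeightOneSpectrum.adicCompletion ℚ q

/-- Local notation: `𝐃⟦X, U, τ⟧ ℓ = ∑_{j < ℓ−1} j·(τ_ℓ)_*^j`, Kolyvagin's derivative operator of the
place `ℓ` on `H¹(U, X)` for the generator `τ_ℓ` (THEOREM C's notation). -/
local notation3 (prettyPrint := false) "𝐃⟦" X ", " U ", " τ "⟧" =>
  fun ℓ : HeightOneSpectrum (𝓞 ℚ) =>
  ∑ j ∈ Finset.range (((primesEquiv ℓ : Nat.Primes) : ℕ) - 1),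
    (j : Module.End ℤ_[p] (continuousCohomology 1 (subgroupRep X U))) *
      (conjMap X U ((τ : HeightOneSpectrum (𝓞 ℚ) → absoluteGaloisGroup ℚ) ℓ) 1).hom.toLinearMap ^ j

/-- Local notation: `𝐫⟦f, T′, U⟧ = f_* : H¹(U, T_pE) → H¹(U, T′)` (THEOREM C's notation). -/
local notation3 (prettyPrint := false) "𝐫⟦" f ", " Tg ", " U "⟧" =>
  ContinuousCohomology.map (ContinuousMonoidHom.id _)
    (X := subgroupRep (ContinuousRep.toTopRep T∞) U)
    (Y := subgroupRep (ContinuousRep.toTopRep Tg) U)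
    ((TopRep.resFunctor (Subgroup.subtype U)).map f) 1

/-- **THEOREM D-tr for `T_pE` over `ℚ`, cocycle level** ([MR04] App. A Thm. A.4 in the `(X−1)²`
case: the derivative class is transverse at `q ∈ n`).  See the module docstring for the data.  For
every representative `Φ` of the derivative class `κ` (`res κ = D_n red_* c_n`) and every local
arithmetic Frobenius `φ₁ ∈ Γ_{ℚ_q}` fixing `μ_q`: there is `t₁ ∈ T′` with
`Φ(res φ₁) = res φ₁ · t₁ − t₁` and `Φ(res τ) = res τ · t₁ − t₁` for all `τ ∈ I_{ℚ_q}` fixing `μ_q`.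
Displayed: `hM` (`p^k T′ = 0`), `hKol`, INST `hσ hcov hinj`, `h0`, `hT'`, `hκ`.
[cite: MazurRubin2004, App. A, Thm. A.4 (p. 80)] [cite: Rubin2000, Thm. 4.5.1] -/
theorem exists_apply_eq_rho_sub_of_deriv (hp2 : p ≠ 2)
    {c : ∀ (i : ℕ) (r : (𝓛).Ideals), H1 T∞ ((𝓛).level i r.1)} (hc : IsEulerSystem 𝓛 T∞ p c)
    {M' : Type} [AddCommGroup M'] [Module ℤ_[p] M'] [TopologicalSpace M'] [IsTopologicalAddGroup M']
    [ContinuousSMul ℤ_[p] M'] {T' : GaloisRep ℚ ℤ_[p] M'} (red : T∞.toTopRep ⟶ T'.toTopRep)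
    {k : ℕ} (hk : 0 < k) (hM : ∀ m : M', ((p : ℤ_[p]) ^ k) • m = 0)
    (n : (𝓛).Ideals) {q : HeightOneSpectrum (𝓞 ℚ)} (hq : q ∈ n.1)
    [Fact (Nat.Prime ((primesEquiv q : Nat.Primes) : ℕ))]
    [NeZero ((((primesEquiv q : Nat.Primes) : ℕ) : ℕ) : ℚ⟦q⟧)]
    (hKol : ∀ ℓ ∈ n.1, Kato.IsKolyvaginPrime W p k ((primesEquiv ℓ : Nat.Primes) : ℕ))
    (σ : HeightOneSpectrum (𝓞 ℚ) → absoluteGaloisGroup ℚ)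
    (hσ : ∀ ℓ ∈ n.1, ∀ ℓ₂ ∈ n.1, ℓ₂ ≠ ℓ → σ ℓ ∈ (𝓛).tameLevel ℓ₂)
    (hcov : ∀ ℓ ∈ n.1, ∀ g : absoluteGaloisGroup ℚ,
      ∃ j < ((primesEquiv ℓ : Nat.Primes) : ℕ) - 1, (σ ℓ ^ j)⁻¹ * g ∈ (𝓛).tameLevel ℓ)
    (hinj : ∀ ℓ ∈ n.1, ∀ j₁ < ((primesEquiv ℓ : Nat.Primes) : ℕ) - 1,
      ∀ j₂ < ((primesEquiv ℓ : Nat.Primes) : ℕ) - 1,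
        (σ ℓ ^ j₁)⁻¹ * σ ℓ ^ j₂ ∈ (𝓛).tameLevel ℓ → j₁ = j₂)
    (h0 : ∀ v : T'.toTopRep,
      (∀ u : ((𝓛).level ⊥ n.1), T'.toTopRep.ρ (u : absoluteGaloisGroup ℚ) v = v) → v = 0)
    (hT' : T'.IsUnramifiedAt q)
    (comm) (κ : continuousCohomology 1 T'.toTopRep)
    (hκ : resSubgroup T'.toTopRep ((𝓛).level ⊥ n.1) 1 κ =
      (n.1.noncommProd 𝐃⟦T'.toTopRep, ((𝓛).level ⊥ n.1), σ⟧ comm)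
        (𝐫⟦red, T', ((𝓛).level ⊥ n.1)⟧ (c ⊥ n)))
    (Φ : contOneCocycles T'.toTopRep) (hΦ : oneCocycleClass _ Φ = κ)
    {φ₁ : absoluteGaloisGroup (ℚ⟦q⟧)} (hφ₁ : IsFrobPow φ₁ 1)
    (hφ₁q : modPCyclotomicCharacterZMod (ℚ⟦q⟧) ((primesEquiv q : Nat.Primes) : ℕ) φ₁ = 1) :
    ∃ t₁ : M', Φ.1 (absGaloisRestrict ℚ (ℚ⟦q⟧) φ₁) =
        T'.toTopRep.ρ (absGaloisRestrict ℚ (ℚ⟦q⟧) φ₁) t₁ - t₁ ∧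
      ∀ τ ∈ absInertia (ℚ⟦q⟧),
        modPCyclotomicCharacterZMod (ℚ⟦q⟧) ((primesEquiv q : Nat.Primes) : ℕ) τ = 1 →
        Φ.1 (absGaloisRestrict ℚ (ℚ⟦q⟧) τ) =
          T'.toTopRep.ρ (absGaloisRestrict ℚ (ℚ⟦q⟧) τ) t₁ - t₁ := by
  classical
  -- §0 the Kolyvagin prime `q`
  have hq'p : ((primesEquiv q : Nat.Primes) : ℕ).Prime := (primesEquiv q).2
  have hqP : q ∈ (𝓛).primes := n.2 q hq
  have hKq : Kato.IsKolyvaginPrime W p k ((primesEquiv q : Nat.Primes) : ℕ) := hKol q hq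
  have hne : ((primesEquiv q : Nat.Primes) : ℕ) ≠ p := hKq.ne
  have h2 : ∀ ℓ ∈ n.1, ((primesEquiv ℓ : Nat.Primes) : ℕ) ≠ 2 := fun ℓ hℓ =>
    Derivative.Rat.ne_two_of_isKolyvaginPrime W p hk (hKol ℓ hℓ)
  have hgood : W.HasGoodReductionAt q :=
    CyclotomicLevel.Rat.hasGoodReductionAt_of_isKolyvaginPrime W hKq
  have hpv : ((p : ℕ) : 𝓞 ℚ) ∉ q.asIdeal :=
    Rat.natCast_not_mem_asIdeal_of_not_dvd fun h =>
      hne ((Nat.prime_dvd_prime_iff_eq hq'p (Fact.out : p.Prime)).mp h)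
  -- §1 the marked Frobenius `Frq = res φ₁` at `𝔓₀`, Frobenii at every place, the exponent `f`
  have h𝔓₀ := adicCompletionPrime_mem_primesAbove ℚ q
  have hFrq𝔓 : IsArithFrobAt (𝓞 ℚ) (absGaloisRestrict ℚ (ℚ⟦q⟧) φ₁) (adicCompletionPrime ℚ q) :=
    isArithFrobAt_absGaloisRestrict_of_isFrobPow_one q hφ₁
  have hFrqP : IsArithFrobAtPlace ℚ q (absGaloisRestrict ℚ (ℚ⟦q⟧) φ₁) := ⟨_, h𝔓₀, hFrq𝔓⟩
  have hFrq : absGaloisRestrict ℚ (ℚ⟦q⟧) φ₁ ∈ (𝓛).tameLevel q :=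
    absGaloisRestrict_mem_tameLevel S q hφ₁q
  have hFrex : ∀ ℓ : HeightOneSpectrum (𝓞 ℚ), ∃ Fr : absoluteGaloisGroup ℚ,
      IsArithFrobAtPlace ℚ ℓ Fr := fun ℓ =>
    (CyclotomicLevel.Rat.exists_isArithFrobAtPlace_mem_tameLevel p S ℓ).imp fun _ h => h.1
  choose Fr hFr using hFrex
  obtain ⟨-, f, r₀, -, -, hf, hft, -, -, -⟩ :=
    CyclotomicLevel.Rat.exists_frobenius_pow_datum (p := p) (S := S) q n.1 hk hKq.modEq_one
  obtain ⟨u, hu⟩ : IsUnit (((((primesEquiv q : Nat.Primes) : ℕ) : ℕ)) : ℤ_[p]) :=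
    PadicCharacter.isUnit_natCast_of_not_dvd fun h =>
      hne ((Nat.prime_dvd_prime_iff_eq (Fact.out : p.Prime) hq'p).mp h).symm
  have hram : ∀ ℓ ∈ n.1, ∀ s ⊆ n.1, ℓ ∉ s →
      ¬ SubgroupIsUnramifiedAt ℚ ((𝓛).level ⊥ (insert ℓ s)) ℓ := fun ℓ hℓ s _ _ =>
    CyclotomicLevel.Rat.not_subgroupIsUnramifiedAt_cyclotomicLevelsRat_level_insert p S ⊥
      (h2 ℓ hℓ) s
  have hN1 : ∀ ℓ ∈ n.1, 1 ≤ ((primesEquiv ℓ : Nat.Primes) : ℕ) - 1 := fun ℓ _ =>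
    Nat.one_le_iff_ne_zero.mpr (Nat.sub_ne_zero_of_lt (primesEquiv ℓ).2.one_lt)
  -- §2 the inertia group `Iq = I_{𝔓₀} = res (I_{ℚ_q})`
  have hIqT : ∀ i ∈ (adicCompletionPrime ℚ q).inertia (absoluteGaloisGroup ℚ),
      ∀ x : T∞.toTopRep, T∞.toTopRep.ρ i x = x := fun i hi x => by
    have h := W.galoisRepTate_eq_one_of_mem_inertia p hgood hpv h𝔓₀ hi
    change W.galoisRepTate p i x = x
    rw [h]; rfl
  have hIqT' : ∀ i ∈ (adicCompletionPrime ℚ q).inertia (absoluteGaloisGroup ℚ),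
      ∀ v : T'.toTopRep, T'.toTopRep.ρ i v = v := fun i hi v =>
    DFunLike.congr_fun (hT' _ h𝔓₀ i hi) v
  have hIvan : ∀ (ψ : contOneCocycles (subgroupRep T∞.toTopRep ((𝓛).level ⊥ n.1)))
      (v : (𝓛).level ⊥ n.1),
      (v : absoluteGaloisGroup ℚ) ∈ (adicCompletionPrime ℚ q).inertia (absoluteGaloisGroup ℚ) →
        ψ.1 v = 0 := fun ψ v hv =>
    Derivative.Inertia.apply_eq_zero_of_mem_inertia_of_mem_tate W p _ ((𝓛).isOpen_level _ _) hpv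
      hgood ψ h𝔓₀ hv v.2
  -- §3 `T^{Frq^f = 1} = 0` (Weil)
  have h0loc : ∀ x : T∞.toTopRep,
      T∞.toTopRep.ρ (absGaloisRestrict ℚ (ℚ⟦q⟧) φ₁ ^ f) x = x → x = 0 := by
    intro x hx
    have hinj := injective_galoisRepTate_pow_sub_one_of_isArithFrobAtPlace W p hpv hgood hFrqP
      (Nat.pos_of_ne_zero hf)
    refine hinj ?_
    change W.galoisRepTate p _ x - x = W.galoisRepTate p _ 0 - 0
    rw [map_zero, sub_zero, sub_eq_zero]
    exact hx
  have hFrqg₀ : (absGaloisRestrict ℚ (ℚ⟦q⟧) φ₁ ^ f)⁻¹ *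
      ((absGaloisRestrict ℚ (ℚ⟦q⟧) φ₁)⁻¹ * absGaloisRestrict ℚ (ℚ⟦q⟧) φ₁ ^ f *
        absGaloisRestrict ℚ (ℚ⟦q⟧) φ₁) ∈
      (adicCompletionPrime ℚ q).inertia (absoluteGaloisGroup ℚ) := by
    rw [mul_assoc, (Commute.pow_self _ f).eq, inv_mul_cancel_left, inv_mul_cancel]
    exact Subgroup.one_mem _
  -- §4 file 3b
  obtain ⟨t₁, ht₁, hI⟩ := Transverse.exists_apply_eq_rho_sub_of_deriv (T' := T') hc red n σ
    (fun ℓ => ((primesEquiv ℓ : Nat.Primes) : ℕ) - 1) Fr hσ hcov hinj hN1 (fun ℓ _ => hFr ℓ) hram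
    comm hq
    (C (↑u⁻¹ : ℤ_[p]) * (C (W.frobeniusTrace (primesEquiv q) : ℤ_[p]) * X -
      C ((((primesEquiv q : Nat.Primes) : ℕ) : ℤ_[p]) + 1) * X ^ 2))
    ((p : ℤ_[p]) ^ k)
    (fun ℓ hℓ => exists_natCast_sub_one_eq_pow_mul (hKol ℓ hℓ).modEq_one)
    (fun ℓ hℓ _ => exists_rubinEulerFactor_eq_sq_add W (hKol ℓ hℓ) (hFr ℓ))
    (exists_rubinEulerFactor_sub_eq_sq_add W hKq (hFr q) u hu)
    {g : absoluteGaloisGroup ℚ | ∃ 𝔔 ∈ q.primesAbove, ∃ φ : absoluteGaloisGroup ℚ,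
      IsArithFrobAt (𝓞 ℚ) φ 𝔔 ∧ φ ∈ (𝓛).tameLevel q ∧ g = φ ^ f}
    (fun g hg => mem_level_of_mem_frobeniusPowSet S hqP n.1 hft hg)
    (fun g hg h => conj_mem_frobeniusPowSet S q f hg h)
    (by
      intro m h₁ h₂ hqm g hg
      obtain ⟨𝔔, h𝔔, φ, hφ, hφq, rfl⟩ := hg
      exact Transverse.Rat.exists_rep_apply_eq_rho_sub_of_frobenius_pow W S hp2 hc hk n m hqP hqm
        hKq h₁ h₂ (hFr q) u hu h𝔔 hφ hφq hf _)
    hM (sum_range_natCast_smul_eq_zero hp2 hKq.modEq_one hM) h0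
    ((adicCompletionPrime ℚ q).inertia (absoluteGaloisGroup ℚ)) hIqT hIqT' hIvan
    (g₀ := absGaloisRestrict ℚ (ℚ⟦q⟧) φ₁ ^ f)
    ⟨_, h𝔓₀, absGaloisRestrict ℚ (ℚ⟦q⟧) φ₁, hFrq𝔓, hFrq, rfl⟩ h0loc hFrq hFrqg₀ κ hκ Φ hΦ
  -- §5 read off the values on `res (I_{ℚ_q} ∩ ker χ̄_q) ⊆ I_{𝔓₀} ∩ G_{ℚ(μ_n)}`
  refine ⟨t₁, ht₁, fun τ hτ hτq => ?_⟩
  have hτI : absGaloisRestrict ℚ (ℚ⟦q⟧) τ ∈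
      (adicCompletionPrime ℚ q).inertia (absoluteGaloisGroup ℚ) := by
    rw [inertia_adicCompletionPrime_eq_map_absInertia]
    exact Subgroup.mem_map_of_mem _ hτ
  exact hI ⟨_, absGaloisRestrict_mem_level_of_mem_absInertia S q n.1 hτ hτq⟩ hτI

/-- **THEOREM D-tr for `T_pE` over `ℚ`, class level in the consumer's `ℤ`-currency**: with the
data of `exists_apply_eq_rho_sub_of_deriv`, a discrete Galois module `ρM` on a group `M`, an
additive `Γ_ℚ`-equivariant `e : T′ → M` (`he`), and the class `κℤ` of any cocycle `Φℤ` with values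
`e ∘ Φ` for the representative `Φ` of `κ` (`hΦℤ` — the (G-ℤ) glue), the localisation of `κℤ` at `q`
lies in the cyclotomic
transverse condition `H¹_tr(ℚ_q, T′) = ker (H¹(ℚ_q, T′) → H¹(ℚ_q(μ_q), T′))`:
`loc_q κℤ ∈ cyclotomicTransverse ρM (Sum.inr q)` (file 4a
`localization_mem_transverseSubgroup_of_apply_frob` at a local Frobenius fixing `μ_q`, file 4c
`exists_isFrobPow_one_modPCyclotomicCharacterZMod_eq_one`; `absNorm q = q`).
[cite: MazurRubin2004, App. A, Thm. A.4 (p. 80) and Def. 1.1.6 (iv)]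
[cite: Rubin2011, Def. 1.9.4 (p. 14)] -/
theorem localization_deriv_mem_cyclotomicTransverse (hp2 : p ≠ 2)
    {c : ∀ (i : ℕ) (r : (𝓛).Ideals), H1 T∞ ((𝓛).level i r.1)} (hc : IsEulerSystem 𝓛 T∞ p c)
    {M' : Type} [AddCommGroup M'] [Module ℤ_[p] M'] [TopologicalSpace M'] [IsTopologicalAddGroup M']
    [ContinuousSMul ℤ_[p] M'] {T' : GaloisRep ℚ ℤ_[p] M'} (red : T∞.toTopRep ⟶ T'.toTopRep)
    {k : ℕ} (hk : 0 < k) (hM : ∀ m : M', ((p : ℤ_[p]) ^ k) • m = 0)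
    (n : (𝓛).Ideals) {q : HeightOneSpectrum (𝓞 ℚ)} (hq : q ∈ n.1)
    (hKol : ∀ ℓ ∈ n.1, Kato.IsKolyvaginPrime W p k ((primesEquiv ℓ : Nat.Primes) : ℕ))
    (σ : HeightOneSpectrum (𝓞 ℚ) → absoluteGaloisGroup ℚ)
    (hσ : ∀ ℓ ∈ n.1, ∀ ℓ₂ ∈ n.1, ℓ₂ ≠ ℓ → σ ℓ ∈ (𝓛).tameLevel ℓ₂)
    (hcov : ∀ ℓ ∈ n.1, ∀ g : absoluteGaloisGroup ℚ,
      ∃ j < ((primesEquiv ℓ : Nat.Primes) : ℕ) - 1, (σ ℓ ^ j)⁻¹ * g ∈ (𝓛).tameLevel ℓ)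
    (hinj : ∀ ℓ ∈ n.1, ∀ j₁ < ((primesEquiv ℓ : Nat.Primes) : ℕ) - 1,
      ∀ j₂ < ((primesEquiv ℓ : Nat.Primes) : ℕ) - 1,
        (σ ℓ ^ j₁)⁻¹ * σ ℓ ^ j₂ ∈ (𝓛).tameLevel ℓ → j₁ = j₂)
    (h0 : ∀ v : T'.toTopRep,
      (∀ u : ((𝓛).level ⊥ n.1), T'.toTopRep.ρ (u : absoluteGaloisGroup ℚ) v = v) → v = 0)
    (hT' : T'.IsUnramifiedAt q)
    (comm) (κ : continuousCohomology 1 T'.toTopRep)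
    (hκ : resSubgroup T'.toTopRep ((𝓛).level ⊥ n.1) 1 κ =
      (n.1.noncommProd 𝐃⟦T'.toTopRep, ((𝓛).level ⊥ n.1), σ⟧ comm)
        (𝐫⟦red, T', ((𝓛).level ⊥ n.1)⟧ (c ⊥ n)))
    (Φ : contOneCocycles T'.toTopRep) (hΦ : oneCocycleClass _ Φ = κ)
    {M : Type} [AddCommGroup M] [TopologicalSpace M] [DiscreteTopology M]
    (ρM : DiscreteGaloisModule ℚ M) (e : M' →+ M)
    (he : ∀ (g : absoluteGaloisGroup ℚ) (m : M'), e (T' g m) = ρM g (e m))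
    (κℤ : galoisCohomology ρM 1) (Φℤ : contOneCocycles ρM.toTopRep)
    (hΦℤκ : oneCocycleClass _ Φℤ = κℤ) (hΦℤ : ∀ g : absoluteGaloisGroup ℚ, Φℤ.1 g = e (Φ.1 g)) :
    galoisCohomology.localization ρM (Sum.inr q) 1 κℤ ∈ cyclotomicTransverse ρM (Sum.inr q) := by
  haveI : Fact (Nat.Prime ((primesEquiv q : Nat.Primes) : ℕ)) := ⟨(primesEquiv q).2⟩
  haveI : CharZero (ℚ⟦q⟧) := charZero_of_injective_algebraMap (algebraMap ℚ (ℚ⟦q⟧)).injective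
  haveI : NeZero ((((primesEquiv q : Nat.Primes) : ℕ) : ℕ) : ℚ⟦q⟧) := NeZero.charZero
  obtain ⟨φ₁, hφ₁, hφ₁q⟩ := exists_isFrobPow_one_modPCyclotomicCharacterZMod_eq_one q
  obtain ⟨t₁, ht₁, hI⟩ := exists_apply_eq_rho_sub_of_deriv W S hp2 hc red hk hM n hq hKol σ hσ hcov
    hinj h0 hT' comm κ hκ Φ hΦ hφ₁ hφ₁q
  have hρ : ∀ (g : absoluteGaloisGroup ℚ) (m : M'), e (T'.toTopRep.ρ g m) = ρM g (e m) :=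
    fun g m => he g m
  rw [cyclotomicTransverse_inr, LFunctions.absNorm_asIdeal_eq_primesEquiv, ← hΦℤκ]
  exact localization_mem_transverseSubgroup_of_apply_frob ρM q _ Φℤ (e t₁) hφ₁ hφ₁q
    (by rw [hΦℤ, ht₁, map_sub, hρ]) fun τ hτ hτq => by rw [hΦℤ, hI τ hτ hτq, map_sub, hρ]

/-- **THEOREM D-tr for `T_pE` over `ℚ` along the (G-ℤ) glue map**: for ANY additive
`Ψ : H¹(Γ_ℚ, T′) → H¹(Γ_ℚ, ρM)` computed on cocycles by a continuous additive equivariant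
`e : T′ → M` (GZ-1 `CoeffTransport.exists_addMonoidHom_oneCocycleClass`; `hΨ` is its defining
property; `e = id`, or the inclusion `E[p^k] ↪ E[p^{k+1}]` of GZ-2/GZ-4)
and the derivative class `κ` (`res κ = D_n red_* c_n`):
`loc_q (Ψ κ) ∈ cyclotomicTransverse ρM (Sum.inr q)`.
[cite: MazurRubin2004, App. A, Thm. A.4 (p. 80) and Def. 1.1.6 (iv)]
[cite: Rubin2011, Def. 1.9.4 (p. 14)] -/
theorem localization_map_deriv_mem_cyclotomicTransverse (hp2 : p ≠ 2)
    {c : ∀ (i : ℕ) (r : (𝓛).Ideals), H1 T∞ ((𝓛).level i r.1)} (hc : IsEulerSystem 𝓛 T∞ p c)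
    {M' : Type} [AddCommGroup M'] [Module ℤ_[p] M'] [TopologicalSpace M'] [IsTopologicalAddGroup M']
    [ContinuousSMul ℤ_[p] M'] {T' : GaloisRep ℚ ℤ_[p] M'} (red : T∞.toTopRep ⟶ T'.toTopRep)
    {k : ℕ} (hk : 0 < k) (hM : ∀ m : M', ((p : ℤ_[p]) ^ k) • m = 0)
    (n : (𝓛).Ideals) {q : HeightOneSpectrum (𝓞 ℚ)} (hq : q ∈ n.1)
    (hKol : ∀ ℓ ∈ n.1, Kato.IsKolyvaginPrime W p k ((primesEquiv ℓ : Nat.Primes) : ℕ))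
    (σ : HeightOneSpectrum (𝓞 ℚ) → absoluteGaloisGroup ℚ)
    (hσ : ∀ ℓ ∈ n.1, ∀ ℓ₂ ∈ n.1, ℓ₂ ≠ ℓ → σ ℓ ∈ (𝓛).tameLevel ℓ₂)
    (hcov : ∀ ℓ ∈ n.1, ∀ g : absoluteGaloisGroup ℚ,
      ∃ j < ((primesEquiv ℓ : Nat.Primes) : ℕ) - 1, (σ ℓ ^ j)⁻¹ * g ∈ (𝓛).tameLevel ℓ)
    (hinj : ∀ ℓ ∈ n.1, ∀ j₁ < ((primesEquiv ℓ : Nat.Primes) : ℕ) - 1,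
      ∀ j₂ < ((primesEquiv ℓ : Nat.Primes) : ℕ) - 1,
        (σ ℓ ^ j₁)⁻¹ * σ ℓ ^ j₂ ∈ (𝓛).tameLevel ℓ → j₁ = j₂)
    (h0 : ∀ v : T'.toTopRep,
      (∀ u : ((𝓛).level ⊥ n.1), T'.toTopRep.ρ (u : absoluteGaloisGroup ℚ) v = v) → v = 0)
    (hT' : T'.IsUnramifiedAt q)
    (comm) (κ : continuousCohomology 1 T'.toTopRep)
    (hκ : resSubgroup T'.toTopRep ((𝓛).level ⊥ n.1) 1 κ =
      (n.1.noncommProd 𝐃⟦T'.toTopRep, ((𝓛).level ⊥ n.1), σ⟧ comm)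
        (𝐫⟦red, T', ((𝓛).level ⊥ n.1)⟧ (c ⊥ n)))
    {M : Type} [AddCommGroup M] [TopologicalSpace M] [DiscreteTopology M]
    (ρM : DiscreteGaloisModule ℚ M) (e : M' →+ M) (hec : Continuous e)
    (he : ∀ (g : absoluteGaloisGroup ℚ) (m : M'), e (T' g m) = ρM g (e m))
    (Ψ : continuousCohomology 1 T'.toTopRep →+ galoisCohomology ρM 1)
    (hΨ : ∀ (φ : contOneCocycles T'.toTopRep) (ψ : contOneCocycles ρM.toTopRep),
      (∀ g, ψ.1 g = e (φ.1 g)) → Ψ (oneCocycleClass _ φ) = oneCocycleClass _ ψ) :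
    galoisCohomology.localization ρM (Sum.inr q) 1 (Ψ κ) ∈ cyclotomicTransverse ρM (Sum.inr q) := by
  obtain ⟨Φ, hΦ⟩ := oneCocycleClass_surjective _ κ
  have hmem := CoeffTransport.comp_mem_contOneCocycles T'.toTopRep ρM.toTopRep e hec
    (fun g x => he g x) Φ
  have hcl : oneCocycleClass _ ⟨_, hmem⟩ = Ψ κ := by
    rw [← hΦ]
    exact (hΨ Φ ⟨_, hmem⟩ fun g => rfl).symm
  exact localization_deriv_mem_cyclotomicTransverse W S hp2 hc red hk hM n hq hKol σ hσ hcov hinj h0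
    hT' comm κ hκ Φ hΦ ρM e he (Ψ κ) ⟨_, hmem⟩ hcl fun g => rfl

end Rat

end Transverse

end Derivative

end Summit.BirchSwinnertonDyer.Rank1Residual.GaloisImage

end
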